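import Summits.CriticalPhenomena.SAWScalingLimit.Theorems.SAWRenewalTightnessSubseqIdentificationTiltedOneStep
import Summits.CriticalPhenomena.SAWScalingLimit.Theorems.SAWRenewalTightnessSubseqIdentificationTiltedEnvelope
import HarnessLib

/-!
# The tilted martingale identities (line `boundary-area-law`, RS5b′/T2, Σ): the frozen one-step moments

Line `boundary-area-law` of the crux `SubseqIdentification` (stmt-CriticalPhenomena-0783), restriction
reshape (lead c4, r-c4-5), stub `stub_tiltedBracketMartingale` (Σ) = the bracket half of step (T2) of
the tilted [LSW] Theorem 6.5 (G. F. Lawler, O. Schramm, W. Werner, *Conformal restriction: the chordal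
case*, J. Amer. Math. Soc. **16** (2003), §5 (5.1)–(5.3) and Prop. 5.3): the product
`((Mⁿ)² − κ Cⁿ) · Lᵏ` of the compensated square of the localised image driving function with the
localised compensated restriction martingale is a martingale. First helper file of Σ: **both one-step
moments of the mixed term `ΔW̃ · Ŷ′` for GENERAL exponents `α′ > 0`, `λ′ ≥ 0`, conditionally on the
past** (frozen at time `u`, `υ = concat_u(stop_u β(ω), β(ω₂))`, `ω₂` a fresh Brownian motion), in ONE
statement (`frozenBrk_moments`) — the bracket identity needs them at `(α′, λ′) = (α/2, λ/2)`, where the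
first-order coefficient does NOT vanish (so the coefficient-free form of `…TiltedProductFrozen` does not
suffice). For a past alive at `u` with `B = A_u − W_u` in the controlled class (`2δ₀ ≤ Φ′_B(0)`, `B(0,16ρ₀)`
off `B`, `ρ₀ ≤ 1`), driver bounded by `N` on `[0, u]`, a step `h ≤ 3c₀²/256` (`c₀ = δ₀ρ₀/4000`),
`λ′ h M_m ≤ 1`, `ΔW̃ = imageDrvFnK κ A (u+h) υ − imageDrvFnK κ A u υ`, `Ŷ′ = D_{u+h}(υ)^{α′} e^{−λ′ ∫ᵤ^{u+h} m(υ)}`,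
`s = 6α′ d^{α′} c₂ h`, and any constant `K` of the deterministic product expansion `exists_abs_prod_sub_model_le`:

* `E_{ω₂}[ΔW̃ · Ŷ′] = h d^{α′} c₂ (κ/2 − 3 + κα′) + O(h√h)` (`abs_integral_sub_drift_le` of `SLEImageDriverOneStep`
  applied to `ΔW̃ · Ŷ′ − s`: on the good event `{σ sup_{[0,h]}|B(ω₂)| ≤ c₀}` the product is
  `s + imageDriverModel (d^{α′+1}) (d^{α′} c₂ (1+2α′)) h x + O(hη + h² + |x|³ + h|x|)` by the product expansion on
  top of the deterministic one-step expansions `abs_imageDriverStep_sub_model_le_of_mem_goodEventK` and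
  `abs_compensatedStep_le`; everywhere `|ΔW̃ · Ŷ′ − s| ≤ (3482N + 15080√(u+h) + 1160R + 6α′/ρ₀) + 3482√κ sup|B(ω₂)|`);
* `E_{ω₂}[(ΔW̃ · Ŷ′ − s)²] = κ d² d^{2α′} h + O(h√h)` (`abs_integral_sq_sub_le`);
* `ΔW̃ · Ŷ′` and `(ΔW̃ · Ŷ′ − s)²` are integrable in `ω₂`.

With `(α′, λ′) = (α/2, λ/2)` (`Ŷ′_{α/2,λ/2}² = Ŷ′_{α,λ}`) this is the conditional second moment
`E[(ΔW̃)² Ŷ′_{α,λ}] ≈ κ d² d^α h` of the bracket identity `d⟨W̃⟩ = κ h′(W)² dt` under the tilt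
(sequel `…TiltedBracketMoment`).

References: [LSW] §5 (5.1)–(5.3), Prop. 5.3. No named fact is used. -/

noncomputable section

open MeasureTheory Filter Topology Set Metric Function
open scoped NNReal ENNReal
open Literature.Probability.RandomPlanarGeometry
open Literature.Probability.Process (preWienerMeasure runSup runSup_nonneg integrable_runSup integrable_runSup_sq)

namespace Summit.CriticalPhenomena.SAWScalingLimit.Theorems.SubseqIdentification.BoundaryAreaLaw

open Loewner PathOps

/-! ### The shift -/

section Shift

/-- **The shift `s = 6α′ d^{α′} c₂ h` is `O(h)`**: `|6α′ y c₂ h| ≤ (6α′/ρ₀) h` for `0 ≤ y ≤ 1` (`y = d^{α′}`),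
`|c₂| ≤ 1/ρ₀`, `h ≥ 0`, `α′, ρ₀ > 0` (registered, explicit binders). [folklore] -/
theorem abs_brkShift_le :
    ∀ (α' ρ₀ y c₂ h : ℝ), 0 < α' → 0 < ρ₀ → 0 ≤ y → y ≤ 1 → |c₂| ≤ 1 / ρ₀ → 0 ≤ h →
      |6 * α' * y * c₂ * h| ≤ 6 * α' / ρ₀ * h := by
  intro α' ρ₀ y c₂ h hα' hρ₀ hy0 hy1 hc2 hh0
  rw [abs_mul, abs_mul, abs_mul, abs_of_nonneg hh0, abs_of_nonneg hy0, abs_of_nonneg (by positivity : (0 : ℝ) ≤ 6 * α')]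
  have h1 : 6 * α' * y * |c₂| ≤ 6 * α' * 1 * (1 / ρ₀) :=
    mul_le_mul (mul_le_mul_of_nonneg_left hy1 (by positivity)) hc2 (abs_nonneg _) (by positivity)
  calc _ ≤ 6 * α' * 1 * (1 / ρ₀) * h := mul_le_mul_of_nonneg_right h1 hh0
    _ = 6 * α' / ρ₀ * h := by ring

end Shift

/-! ### Both frozen moments of the mixed term -/

section Frozen

variable [MeasurableSpace C(ℝ≥0, ℝ)] [BorelSpace C(ℝ≥0, ℝ)]
variable {κ : ℝ≥0} {A : Set ℂ} {u h : ℝ≥0} {ω : ℝ≥0 → ℝ} {δ₀ ρ₀ R N : ℝ}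
  (hκ0 : 0 < κ) (hκ : κ ≤ 8 / 3) (hA : IsStarHull A) (hne : A.Nonempty)
  (hR0 : 0 < R) (hAR : A ⊆ closedBall (0 : ℂ) R)
  (halive : Disjoint (closedHull (drvK κ (brownianCPath ω)) u) A) (hρ₀ : 0 < ρ₀) (hρ1 : ρ₀ ≤ 1)
  (hBρ : Disjoint (ball (0 : ℂ) (16 * ρ₀)) (slidHull (drvK κ (brownianCPath ω)) A u))
  (hδ0 : 0 < δ₀) (hδ : 2 * δ₀ ≤ starDeriv (slidHull (drvK κ (brownianCPath ω)) A u)) (hh0 : 0 < h)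
  (hh : (h : ℝ) ≤ 3 * (δ₀ * ρ₀ / 4000) ^ 2 / 256)
  (hN0 : 0 ≤ N) (hN : ∀ s : ℝ≥0, s ≤ u → |drvK κ (brownianCPath ω) s| ≤ N)

include hκ0 hκ hA hne hR0 hAR halive hρ₀ hρ1 hBρ hδ0 hδ hh0 hh hN0 hN in
-- the one-step assembly (smallness, good event, bad event, measurability, both moments, integrability) in ONE
-- proof needs more than the default heartbeats (each piece elaborates quickly)
set_option maxHeartbeats 800000 in
/-- **Both frozen moments of the product `ΔW̃ · Ŷ′`** ([LSW] §5 (5.1)–(5.3) with Prop. 5.3, one step,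
conditionally on the past): for `α′ > 0`, `λ′ ≥ 0`, `λ′ h M_m ≤ 1` and any constant `K` of the product
expansion, with `s = 6α′d^{α′}c₂h`, `c = c₀√κ/σ`, `M₀ = 3482N + 15080√(u+h) + 1160R`, `M₁ = 3482√κ`:

  `|E_{ω₂}[ΔW̃ · Ŷ′] − h · d^{α′} c₂ (κ/2 − 3 + κ α′)| ≤ imageStepC κ c (d·d^{α′}) (d^{α′}c₂(1+2α′)) K (M₀ + 6α′/ρ₀) M₁ · h√h`,
  `|E_{ω₂}[(ΔW̃ · Ŷ′ − s)²] − κ (d · d^{α′})² h| ≤ imageStepC₂ κ c (d·d^{α′}) (d^{α′}c₂(1+2α′)) K (M₀ + 6α′/ρ₀) M₁ · h√h`,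

and `ΔW̃ · Ŷ′`, `(ΔW̃ · Ŷ′ − s)²` are integrable in `ω₂` (the good-event product expansion on top of
`abs_imageDriverStep_sub_model_le_of_mem_goodEventK` / `abs_compensatedStep_le`, the bad-event envelope
`abs_imageDrvFnK_concat_sub_le_of_abs_le`, then `abs_integral_sub_drift_le` and `abs_integral_sq_sub_le`).
[cite: LawlerSchrammWerner2003Restriction, §5 (5.1)–(5.3) and Prop. 5.3] -/
theorem frozenBrk_moments {α' lam' : ℝ} (hα' : 0 < α') (hlam' : 0 ≤ lam') (hlamh : lam' * (h * massBound δ₀ ρ₀) ≤ 1)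
    {K : ℝ} (hK0 : 0 ≤ K)
    (hK : ∀ {d c₂ c₃ m x ZM Yh r : ℝ} {u : ℝ≥0}, δ₀ ≤ d → d ≤ 1 →
      |c₂| ≤ 1 / ρ₀ → |c₃| ≤ 2 / ρ₀ ^ 2 → |m| ≤ massBound δ₀ ρ₀ → |x| ≤ 1 → (u : ℝ) ≤ 1 → 0 ≤ Yh → Yh ≤ 1 →
      (u : ℝ) ^ 2 ≤ r → |x| ^ 3 ≤ r → u * |x| ≤ r →
      |ZM - imageDriverModel d c₂ u x| ≤ stepK δ₀ ρ₀ * r →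
      |Yh - d ^ α' - (stepModelK α' d c₂ c₃ u x - lam' * u * m * d ^ α')| ≤ compK α' lam' δ₀ ρ₀ * (stepSigma / Real.sqrt κ) * r →
      |ZM * Yh - 6 * α' * d ^ α' * c₂ * u - imageDriverModel (d * d ^ α') (d ^ α' * c₂ * (1 + 2 * α')) u x| ≤ K * r) :
    |∫ ω₂, (imageDrvFnK κ A (u + h) (concat u (stop u (brownianCPath ω), brownianCPath ω₂)) -
            imageDrvFnK κ A u (concat u (stop u (brownianCPath ω), brownianCPath ω₂))) *
          (DFnK κ A (u + h) (concat u (stop u (brownianCPath ω), brownianCPath ω₂)) ^ α' *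
            Real.exp (-(lam' * JFnK κ A u h (concat u (stop u (brownianCPath ω), brownianCPath ω₂))))) ∂preWienerMeasure -
        h * (starDeriv (slidHull (drvK κ (brownianCPath ω)) A u) ^ α' * starJet2 (slidHull (drvK κ (brownianCPath ω)) A u) *
          ((κ : ℝ) / 2 - 3 + κ * α'))| ≤
      imageStepC κ (δ₀ * ρ₀ / 4000 * (Real.sqrt κ / stepSigma))
          (starDeriv (slidHull (drvK κ (brownianCPath ω)) A u) * starDeriv (slidHull (drvK κ (brownianCPath ω)) A u) ^ α')
          (starDeriv (slidHull (drvK κ (brownianCPath ω)) A u) ^ α' * starJet2 (slidHull (drvK κ (brownianCPath ω)) A u) * (1 + 2 * α'))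
          K ((3482 * N + (15080 * Real.sqrt ((u + h : ℝ≥0) : ℝ) + 1160 * R) + 6 * α' / ρ₀)) (3482 * Real.sqrt κ) *
        h * Real.sqrt h ∧
    |∫ ω₂, ((imageDrvFnK κ A (u + h) (concat u (stop u (brownianCPath ω), brownianCPath ω₂)) -
            imageDrvFnK κ A u (concat u (stop u (brownianCPath ω), brownianCPath ω₂))) *
          (DFnK κ A (u + h) (concat u (stop u (brownianCPath ω), brownianCPath ω₂)) ^ α' *
            Real.exp (-(lam' * JFnK κ A u h (concat u (stop u (brownianCPath ω), brownianCPath ω₂))))) -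
          6 * α' * starDeriv (slidHull (drvK κ (brownianCPath ω)) A u) ^ α' * starJet2 (slidHull (drvK κ (brownianCPath ω)) A u) * h) ^ 2
          ∂preWienerMeasure -
        κ * (starDeriv (slidHull (drvK κ (brownianCPath ω)) A u) * starDeriv (slidHull (drvK κ (brownianCPath ω)) A u) ^ α') ^ 2 * h| ≤
      imageStepC₂ κ (δ₀ * ρ₀ / 4000 * (Real.sqrt κ / stepSigma))
          (starDeriv (slidHull (drvK κ (brownianCPath ω)) A u) * starDeriv (slidHull (drvK κ (brownianCPath ω)) A u) ^ α')
          (starDeriv (slidHull (drvK κ (brownianCPath ω)) A u) ^ α' * starJet2 (slidHull (drvK κ (brownianCPath ω)) A u) * (1 + 2 * α'))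
          K ((3482 * N + (15080 * Real.sqrt ((u + h : ℝ≥0) : ℝ) + 1160 * R) + 6 * α' / ρ₀)) (3482 * Real.sqrt κ) *
        h * Real.sqrt h ∧
    Integrable (fun ω₂ ↦ (imageDrvFnK κ A (u + h) (concat u (stop u (brownianCPath ω), brownianCPath ω₂)) -
          imageDrvFnK κ A u (concat u (stop u (brownianCPath ω), brownianCPath ω₂))) *
        (DFnK κ A (u + h) (concat u (stop u (brownianCPath ω), brownianCPath ω₂)) ^ α' *
          Real.exp (-(lam' * JFnK κ A u h (concat u (stop u (brownianCPath ω), brownianCPath ω₂)))))) preWienerMeasure ∧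
    Integrable (fun ω₂ ↦ ((imageDrvFnK κ A (u + h) (concat u (stop u (brownianCPath ω), brownianCPath ω₂)) -
            imageDrvFnK κ A u (concat u (stop u (brownianCPath ω), brownianCPath ω₂))) *
          (DFnK κ A (u + h) (concat u (stop u (brownianCPath ω), brownianCPath ω₂)) ^ α' *
            Real.exp (-(lam' * JFnK κ A u h (concat u (stop u (brownianCPath ω), brownianCPath ω₂))))) -
        6 * α' * starDeriv (slidHull (drvK κ (brownianCPath ω)) A u) ^ α' * starJet2 (slidHull (drvK κ (brownianCPath ω)) A u) * h) ^ 2)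
        preWienerMeasure := by
  -- adapted from SAWRenewalTightnessSubseqIdentificationTiltedFrozen.lean (`frozen_smallnessK`, `frozen_prod_good`,
  -- `frozen_prod_bad`, `measurable_frozen_prod`, `frozen_prod_integral_sub_le`, `frozen_prod_sq_integral_sub_le`), in one proof
  haveI := isProbabilityMeasure_preWienerMeasure'
  -- smallness: `h ≤ c₀²/32`, `32h ≤ c₀²`, `32κh ≤ c²`, `h ≤ 1`, `0 < c ≤ 1`
  have hd1u := (starDeriv_pos_le_one (slidHull (drvK κ (brownianCPath ω)) A u)).2
  have hδ1 : δ₀ ≤ 1 := by linarith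
  have hκ' : (0 : ℝ) < κ := by exact_mod_cast hκ0
  have hsκ : 0 < Real.sqrt κ := Real.sqrt_pos.2 hκ'
  have hσ := stepSigma_pos
  have hc00 : 0 < δ₀ * ρ₀ / 4000 := by positivity
  have hc01 : δ₀ * ρ₀ / 4000 ≤ 1 / 4000 := by
    rw [div_le_div_iff_of_pos_right (by norm_num)]
    have := mul_le_mul hδ1 hρ1 hρ₀.le zero_le_one
    linarith
  have hratio : Real.sqrt κ / stepSigma ≤ 1 := by rw [div_le_one hσ]; exact sqrt_le_stepSigma hκ
  have hratio0 : 0 < Real.sqrt κ / stepSigma := by positivity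
  have hh0' : (0 : ℝ) ≤ h := h.coe_nonneg
  have hsq : (δ₀ * ρ₀ / 4000 * (Real.sqrt κ / stepSigma)) ^ 2 = (δ₀ * ρ₀ / 4000) ^ 2 * (κ * (3 / 8)) := by
    rw [mul_pow, div_pow, div_pow, Real.sq_sqrt hκ'.le, stepSigma_sq]; ring
  have hh32' : (h : ℝ) ≤ (δ₀ * ρ₀ / 4000) ^ 2 / 32 := by nlinarith
  have hh32 : 32 * (h : ℝ) ≤ (δ₀ * ρ₀ / 4000) ^ 2 := by nlinarith
  have hhκ : 32 * (κ : ℝ) * h ≤ (δ₀ * ρ₀ / 4000 * (Real.sqrt κ / stepSigma)) ^ 2 := by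
    rw [hsq]
    have := mul_le_mul_of_nonneg_left hh (by positivity : (0 : ℝ) ≤ 32 * κ)
    nlinarith
  have hh1 : (h : ℝ) ≤ 1 := by
    have : (δ₀ * ρ₀ / 4000) ^ 2 ≤ 1 := by nlinarith
    nlinarith
  have hc0 : 0 < δ₀ * ρ₀ / 4000 * (Real.sqrt κ / stepSigma) := by positivity
  have hc1 : δ₀ * ρ₀ / 4000 * (Real.sqrt κ / stepSigma) ≤ 1 := by
    have : δ₀ * ρ₀ / 4000 * (Real.sqrt κ / stepSigma) ≤ 1 / 4000 * 1 := mul_le_mul hc01 hratio hratio0.le (by norm_num)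
    linarith
  -- the class at the frozen time
  set B := slidHull (drvK κ (brownianCPath ω)) A u with hBdef
  have hB : IsStarHull B := Loewner.isStarHull_slidHull_of_disjoint (continuous_drvK κ _) hA halive
  have hBρ8 : Disjoint (ball (0 : ℂ) (8 * ρ₀)) B := hBρ.mono_left (ball_subset_ball (by linarith))
  obtain ⟨hd0, hd1, -⟩ := starDeriv_spec hB
  have hδ' : δ₀ ≤ starDeriv B := by linarith
  obtain ⟨-, -, hc2, hc3, -⟩ := starJet_spec hB hρ₀ hBρ8
  set d : ℝ := starDeriv B with hd
  set c₂ : ℝ := starJet2 B with hc₂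
  have hy0 : 0 ≤ d ^ α' := Real.rpow_nonneg hd0.le _
  have hy1 : d ^ α' ≤ 1 := Real.rpow_le_one hd0.le hd1 hα'.le
  set s : ℝ := 6 * α' * d ^ α' * c₂ * h with hs
  set M₀ : ℝ := (3482 * N + (15080 * Real.sqrt ((u + h : ℝ≥0) : ℝ) + 1160 * R)) + 6 * α' / ρ₀ with hM₀
  have hM₀0 : 0 ≤ M₀ := by positivity
  have hM₁ : (0 : ℝ) ≤ 3482 * Real.sqrt κ := by positivity
  set Z : (ℝ≥0 → ℝ) → ℝ := fun ω₂ ↦ (imageDrvFnK κ A (u + h) (concat u (stop u (brownianCPath ω), brownianCPath ω₂)) -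
      imageDrvFnK κ A u (concat u (stop u (brownianCPath ω), brownianCPath ω₂))) *
    (DFnK κ A (u + h) (concat u (stop u (brownianCPath ω), brownianCPath ω₂)) ^ α' *
      Real.exp (-(lam' * JFnK κ A u h (concat u (stop u (brownianCPath ω), brownianCPath ω₂))))) with hZ
  -- `Ŷ′ ∈ [0, 1]`
  have hYh01 : ∀ υ : C(ℝ≥0, ℝ), 0 ≤ DFnK κ A (u + h) υ ^ α' * Real.exp (-(lam' * JFnK κ A u h υ)) ∧
      DFnK κ A (u + h) υ ^ α' * Real.exp (-(lam' * JFnK κ A u h υ)) ≤ 1 := fun υ ↦ by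
    obtain ⟨-, -, e0, e1⟩ := DFnK_eq (κ := κ) (A := A) (u + h) υ
    have c1 : Real.exp (-(lam' * JFnK κ A u h υ)) ≤ 1 := by
      rw [Real.exp_le_one_iff, neg_nonpos]; exact mul_nonneg hlam' (JFnK_nonneg hA u h υ)
    exact ⟨mul_nonneg (Real.rpow_nonneg e0 _) (Real.exp_pos _).le,
      mul_le_one₀ (Real.rpow_le_one e0 e1 hα'.le) (Real.exp_pos _).le c1⟩
  -- measurability of `Z − s`
  have hZm : Measurable fun ω₂ ↦ Z ω₂ - s := by
    have hc : Measurable fun ω₂ : ℝ≥0 → ℝ ↦ concat u (stop u (brownianCPath ω), brownianCPath ω₂) :=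
      (measurable_concat u).comp (measurable_const.prodMk measurable_brownianCPath)
    have h1 : Measurable fun υ : C(ℝ≥0, ℝ) ↦ imageDrvFnK κ A (u + h) υ - imageDrvFnK κ A u υ :=
      (measurable_imageDrvFnK κ hA hne _).sub (measurable_imageDrvFnK κ hA hne _)
    have h2 : Measurable fun υ : C(ℝ≥0, ℝ) ↦ DFnK κ A (u + h) υ ^ α' * Real.exp (-(lam' * JFnK κ A u h υ)) :=
      ((measurable_DFnK hA hne (u + h)).pow_const _).mul ((measurable_JFnK hA hne u h).const_mul lam').neg.exp
    exact ((h1.comp hc).mul (h2.comp hc)).sub measurable_const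
  -- the bad-event envelope: `|Z − s| ≤ M₀ + M₁ sup|B(ω₂)|`
  have hss : |s| ≤ 6 * α' / ρ₀ := by
    have := abs_brkShift_le α' ρ₀ (d ^ α') c₂ h hα' hρ₀ hy0 hy1 hc2 hh0'
    have h6 : 6 * α' / ρ₀ * (h : ℝ) ≤ 6 * α' / ρ₀ := mul_le_of_le_one_right (by positivity) hh1
    exact this.trans h6
  have hbad : ∀ ω₂, |Z ω₂ - s| ≤ M₀ + 3482 * Real.sqrt κ * runSup h ω₂ := fun ω₂ ↦ by
    have hZenv := abs_imageDrvFnK_concat_sub_le_of_abs_le (κ := κ) (h := h) hA hR0 hAR hN0 hN ω₂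
    have hprod : |Z ω₂| ≤ (3482 * N + (15080 * Real.sqrt ((u + h : ℝ≥0) : ℝ) + 1160 * R)) + 3482 * Real.sqrt κ * runSup h ω₂ := by
      rw [hZ]; simp only
      rw [abs_mul, abs_of_nonneg (hYh01 _).1]
      exact (mul_le_of_le_one_right (abs_nonneg _) (hYh01 _).2).trans hZenv
    calc |Z ω₂ - s| ≤ |Z ω₂| + |s| := abs_sub _ _
      _ ≤ _ := by rw [hM₀]; linarith
  -- the good event: the product expansion on top of the two deterministic one-step expansions
  have hgood : ∀ ω₂ ∈ goodEventK κ (δ₀ * ρ₀ / 4000 * (Real.sqrt κ / stepSigma)) h,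
      |Z ω₂ - s - imageDriverModel (d * d ^ α') (d ^ α' * c₂ * (1 + 2 * α')) h (stepDriverK κ ω₂ h)| ≤
        K * (h * stepSize (Real.sqrt κ * runSup h ω₂) h + h ^ 2 + |stepDriverK κ ω₂ h| ^ 3 + h * |stepDriverK κ ω₂ h|) := by
    intro ω₂ hω₂
    rw [goodEventK_eq_goodEvent hκ0] at hω₂
    set υ := concat u (stop u (brownianCPath ω), brownianCPath ω₂) with hυ
    obtain ⟨hω₂K, hsS, -⟩ := goodEvent_subset_goodEventK hκ0 hκ δ₀ ρ₀ h hω₂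
    set x : ℝ := stepDriverK κ ω₂ h with hx
    set rκ : ℝ := h * stepSize (Real.sqrt κ * runSup h ω₂) h + h ^ 2 + |x| ^ 3 + h * |x| with hrκ
    -- the `W̃`-side
    obtain ⟨-, hZeq⟩ := imageDrvFnK_concat_sub_eq_of_mem_goodEventK (κ := κ) hA halive hρ₀ hρ1 hBρ8 hδ0 hδ' hh0 hh32 hω₂K
    have hM := abs_imageDriverStep_sub_model_le_of_mem_goodEventK hB hρ₀ hρ1 hBρ8 hδ0 hδ' hh0 hh32 hω₂K
    -- the `Y`-side
    obtain ⟨hDeq, -⟩ := DFnK_MFnK_concat_eq_of_good hκ hA halive hρ₀ hBρ hδ0 hδ hh0 hh32' hω₂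
    obtain ⟨hJ0, hJM, hJΔ⟩ := JFnK_concat_bounds hκ hA halive hρ₀ hBρ hδ0 hδ hh0 hh32' hne hω₂
    obtain ⟨hUc, hU0⟩ := continuous_stepDriverK κ ω₂
    set S : ℝ := stepSigma * runSup h ω₂ with hSdef
    have hSU : ∀ v : ℝ≥0, v ≤ h → |stepDriverK κ ω₂ v| ≤ S := fun v hv ↦ abs_stepDriverK_le hκ hv ω₂
    have hω₂' : S ≤ δ₀ * ρ₀ / 4000 := hω₂
    obtain ⟨-, hcc1, h4, -, -, -⟩ := step_smallness hB hρ₀ hρ1 hδ0 hδ' hh32'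
    have hη2 : stepSize S h ≤ 2 * (δ₀ * ρ₀ / 4000) := by rw [stepSize]; linarith
    have hη : stepSize S h ≤ starDeriv B * ρ₀ / 1000 := by
      refine hη2.trans ?_
      rw [show 2 * (δ₀ * ρ₀ / 4000) = δ₀ * ρ₀ / 2000 by ring, div_le_div_iff₀ (by norm_num) (by norm_num)]
      nlinarith [mul_le_mul_of_nonneg_right hδ' hρ₀.le]
    have hη1 : stepSize S h ≤ 1 := by linarith
    have key := abs_compensatedStep_le hB hUc hU0 hh0 hSU hρ₀ hBρ8 hη hα' hlam' hρ1 hδ0 hδ' hη1 hh1 hlamh hJ0 hJM hJΔ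
    -- the step sizes compare
    have hS0 : 0 ≤ stepSize (Real.sqrt κ * runSup h ω₂) h := by
      rw [stepSize]; have := runSup_nonneg h ω₂; positivity
    have hrcomp : (h : ℝ) * stepSize S h + h ^ 2 + |x| ^ 3 + h * |x| ≤ stepSigma / Real.sqrt κ * rκ := by
      have h1 : (h : ℝ) * stepSize S h ≤ stepSigma / Real.sqrt κ * (h * stepSize (Real.sqrt κ * runSup h ω₂) h) := by
        have := mul_le_mul_of_nonneg_left hsS h.coe_nonneg
        linarith
      have h2 : (h : ℝ) ^ 2 + |x| ^ 3 + h * |x| ≤ stepSigma / Real.sqrt κ * (h ^ 2 + |x| ^ 3 + h * |x|) := by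
        have h0 : 0 ≤ (h : ℝ) ^ 2 + |x| ^ 3 + h * |x| := by positivity
        have hratio1 : 1 ≤ stepSigma / Real.sqrt κ := by rw [le_div_iff₀ hsκ, one_mul]; exact sqrt_le_stepSigma hκ
        have := mul_le_mul_of_nonneg_right hratio1 h0
        linarith
      have : stepSigma / Real.sqrt κ * rκ = stepSigma / Real.sqrt κ * (h * stepSize (Real.sqrt κ * runSup h ω₂) h) +
          stepSigma / Real.sqrt κ * (h ^ 2 + |x| ^ 3 + h * |x|) := by rw [hrκ]; ring
      linarith
    have hcompK0 : 0 ≤ compK α' lam' δ₀ ρ₀ := (compK_pos hα' hlam' hδ0 hρ₀).le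
    have hY : |starDeriv (slidHull (stepDriverK κ ω₂) B h) ^ α' * Real.exp (-(lam' * JFnK κ A u h υ)) - starDeriv B ^ α' -
        (stepModelK α' (starDeriv B) (starJet2 B) (starJet3 B) h x -
          lam' * h * bubbleMass (starDeriv B) (starJet2 B / 2) (starJet3 B / 6) * starDeriv B ^ α')| ≤
        compK α' lam' δ₀ ρ₀ * (stepSigma / Real.sqrt κ) * rκ := by
      refine key.trans ?_
      rw [mul_assoc]
      exact mul_le_mul_of_nonneg_left hrcomp hcompK0
    -- the hypotheses of the product expansion
    have hx1 : |x| ≤ 1 := (abs_le_of_mem_goodEventK hω₂K).1.trans (hcc1.trans (by norm_num))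
    have hm : |bubbleMass (starDeriv B) (starJet2 B / 2) (starJet3 B / 6)| ≤ massBound δ₀ ρ₀ := by
      rw [massBound]; exact abs_schwarzMass_le hδ0 hρ₀ hδ' hc2 hc3
    have hYh01' := hYh01 υ
    have hA0 : 0 ≤ (h : ℝ) * stepSize (Real.sqrt κ * runSup h ω₂) h := mul_nonneg h.coe_nonneg hS0
    have hB0 := sq_nonneg (h : ℝ)
    have hC0 : 0 ≤ |x| ^ 3 := pow_nonneg (abs_nonneg x) 3
    have hD0 : 0 ≤ (h : ℝ) * |x| := mul_nonneg h.coe_nonneg (abs_nonneg x)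
    have hr2 : (h : ℝ) ^ 2 ≤ rκ := by rw [hrκ]; linarith
    have hr3 : |x| ^ 3 ≤ rκ := by rw [hrκ]; linarith
    have hrx : (h : ℝ) * |x| ≤ rκ := by rw [hrκ]; linarith
    rw [hDeq] at hYh01'
    rw [hZ, hs]; simp only
    rw [hZeq, hDeq]
    exact hK hδ' hd1 hc2 hc3 hm hx1 hh1 hYh01'.1 hYh01'.2 hr2 hr3 hrx hM hY
  -- the two abstract one-step estimates
  have key1 := abs_integral_sub_drift_le hκ0 hc0 hhκ hh1 hK0 hM₀0 hM₁ hZm hgood hbad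
  have key2 := abs_integral_sq_sub_le hκ0 hc0 hc1 hhκ hh1 hK0 hM₀0 hM₁ hZm hgood hbad
  -- integrability
  have hbadZ : ∀ ω₂, |Z ω₂| ≤ (M₀ + |s|) + 3482 * Real.sqrt κ * runSup h ω₂ := fun ω₂ ↦ by
    have h2 : |Z ω₂| ≤ |Z ω₂ - s| + |s| := by have := abs_add_le (Z ω₂ - s) s; rwa [sub_add_cancel] at this
    linarith [hbad ω₂]
  have hZm' : Measurable Z := by have := hZm.add_const s; simpa using this
  have iZ : Integrable Z preWienerMeasure := integrable_of_abs_le_runSup (h := h) hZm' hbadZ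
  have iZs2 : Integrable (fun ω₂ ↦ (Z ω₂ - s) ^ 2) preWienerMeasure := by
    refine ((integrable_const (2 * M₀ ^ 2)).add ((integrable_runSup_sq h).const_mul (2 * (3482 * Real.sqrt κ) ^ 2))).mono'
      (hZm.pow_const 2).aestronglyMeasurable (Eventually.of_forall fun ω₂ ↦ ?_)
    rw [Real.norm_eq_abs, abs_of_nonneg (sq_nonneg _), Pi.add_apply]
    have h1 : (Z ω₂ - s) ^ 2 ≤ (M₀ + 3482 * Real.sqrt κ * runSup h ω₂) ^ 2 := by
      rw [← sq_abs]; exact pow_le_pow_left₀ (abs_nonneg _) (hbad ω₂) 2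
    have h3 : (M₀ + 3482 * Real.sqrt κ * runSup h ω₂) ^ 2 + (M₀ - 3482 * Real.sqrt κ * runSup h ω₂) ^ 2 =
        2 * M₀ ^ 2 + 2 * (3482 * Real.sqrt κ) ^ 2 * runSup h ω₂ ^ 2 := by ring
    linarith [sq_nonneg (M₀ - 3482 * Real.sqrt κ * runSup h ω₂)]
  -- the first moment: `∫ (Z − s) = ∫ Z − s`, and `s + h · drift = h d^{α′} c₂ (κ/2 − 3 + κα′)`
  have hint : ∫ ω₂, (Z ω₂ - s) ∂preWienerMeasure = ∫ ω₂, Z ω₂ ∂preWienerMeasure - s := by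
    rw [integral_sub iZ (integrable_const s), integral_const]; simp
  rw [hint] at key1
  have hdrift : s + h * imageDriverDrift κ (d ^ α' * c₂ * (1 + 2 * α')) = h * (d ^ α' * c₂ * ((κ : ℝ) / 2 - 3 + κ * α')) := by
    rw [hs, imageDriverDrift]; ring
  have e1 : ∫ ω₂, Z ω₂ ∂preWienerMeasure - s - h * imageDriverDrift κ (d ^ α' * c₂ * (1 + 2 * α')) =
      ∫ ω₂, Z ω₂ ∂preWienerMeasure - h * (d ^ α' * c₂ * ((κ : ℝ) / 2 - 3 + κ * α')) := by rw [← hdrift]; ring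
  rw [e1] at key1
  exact ⟨key1, key2, iZ, iZs2⟩

end Frozen

end Summit.CriticalPhenomena.SAWScalingLimit.Theorems.SubseqIdentification.BoundaryAreaLaw

end
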